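import Mathlib
import Literature.NumberTheory.LFunctions.Zhang2022.Section7ExtendedRangeTail
import Literature.NumberTheory.LFunctions.Zhang2022.Section7Eq711Assembly
import HarnessLib

/-!
# Zhang (2022) §7, G-adj2-1 (F3a): the `r < D` part of the extended-range triple sum

Topic `Literature/NumberTheory/LFunctions/Zhang2022` (Landau–Siegel audit tree; verdict-neutral).
Y. Zhang, *Discrete mean estimates and the Landau–Siegel zero*, arXiv:2211.02515v1 (2022)
[Zhang2022LandauSiegel] — **an unrefereed manuscript under adjudication**. D-0069 campaign, cell
`siegel-zhang`, GAP-LEDGER row G-adj2-1 (the printed (7.13) range `dhr < P₁` vs the (7.2)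
support `dhr < PT⁻²`).

* `sum_tripleX_smallR_le` — the `r < D` part of the (7.13)-shaped triple sum
  `Σ (dhφ(hr)√r)⁻¹ Σ*_θ |𝔰(r,h,d;θ)|` over the FULL (7.2)-support triples (`1 ≤ d, h`, `1 < r`,
  `dhr < PT⁻²`; indices below `Nsupp = ⌈PT⁻²⌉`) is `≤ P²·D^{−1}` for all large `D` under (A):
  per triple the power saving `frakS_le_powX` (F1, `A = 4`), the character count `≤ φ(r) ≤ r`,
  `hr/φ(hr) ≤ 4𝓛¹⁸`, `√r ≤ D`, `#{r < D} ≤ D`, and `Σ_d τ₅(d)/d ≤ 32M₅𝓛⁴⁵`, `Σ_h 1/h ≤ 3𝓛⁹`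
  over `[1, Nsupp)` — the extended-range counterpart of the landed `step7bSmallR_holds`,
  with `Nsupp` in place of `⌈P₁⌉`.
* `nsupp_facts` (private) — the size facts `3 ≤ Nsupp`, `log Nsupp ≤ 2𝓛⁹` the bookkeeping runs on.

Theorems only; 0 new definitions; 0 new facts. The `r ≥ D` dyadic leg, the decl-wanted
extension sum, the honest (7.12)→(7.13) insertion and the closing `Eq711` assembly are the
companion files of the rung.

WHAT THIS IS NOT: any claim about Theorems 1–2 of the manuscript or about Landau–Siegel zeros;
not a proof of (7.11) or of the printed (7.13); no change to the G-adj2-1 row's as-printed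
finding.

## References

* Y. Zhang, arXiv:2211.02515v1 (2022), §7 pp. 37–39, (7.2), (7.13)–(7.15), tex L1813–L2058.
  [cite: Zhang2022LandauSiegel, §7 pp. 37–39]
-/

noncomputable section

open Complex Real Finset

namespace Literature.NumberTheory.LFunctions.Zhang2022.Section7cStatements

open Literature.NumberTheory.LFunctions.Zhang2022.Skeleton

open scoped Classical

/-! ## Elementary helpers (local copies of private lemmas of the lane, unchanged) -/

/-- `log D ≥ 1` once `D ≥ 3` (local copy). [folklore] -/
private theorem one_le_ellS {D : ℕ} (hD : 3 ≤ D) : 1 ≤ Skeleton.ell D := by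
  have hD' : (3 : ℝ) ≤ D := by exact_mod_cast hD
  rw [Skeleton.ell, Real.le_log_iff_exp_le (by linarith)]
  exact le_trans (le_of_lt (lt_trans Real.exp_one_lt_d9 (by norm_num))) hD'

/-- `1 ≤ P` (local copy). [folklore] -/
private theorem one_le_bigPS (D : ℕ) : 1 ≤ Skeleton.bigP D :=
  Real.one_le_exp (by rw [Skeleton.ell]; positivity)

/-- The harmonic bound `Σ_{1≤h<N} 1/h ≤ 1 + log N` (local copy). [folklore] -/
private theorem sum_Ico_inv_le_one_add_logS (N : ℕ) :
    ∑ h ∈ Finset.Ico 1 N, (1 : ℝ) / h ≤ 1 + Real.log N := by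
  rcases Nat.lt_or_ge N 2 with hN | hN
  · interval_cases N
    · simp
    · simp
  have hIco : Finset.Ico 1 N = Finset.Icc 1 (N - 1) := by
    ext h; simp only [Finset.mem_Ico, Finset.mem_Icc]; omega
  have h1 : ∑ h ∈ Finset.Icc 1 (N - 1), (1 : ℝ) / h = (harmonic (N - 1) : ℝ) := by
    rw [harmonic_eq_sum_Icc]; push_cast
    exact Finset.sum_congr rfl fun h _ => by rw [one_div]
  rw [hIco, h1]
  have h2 := harmonic_le_one_add_log (N - 1)
  have h3 : Real.log ((N - 1 : ℕ) : ℝ) ≤ Real.log N :=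
    Real.log_le_log (by exact_mod_cast (by omega : 0 < N - 1)) (by exact_mod_cast Nat.sub_le N 1)
  linarith




/-- Size facts for `N₁ = Nsupp = ⌈PT⁻²⌉`: once `𝓛 ≥ 2`, `3 ≤ N₁` and `log N₁ ≤ 2𝓛⁹`.
[cite: Zhang2022LandauSiegel, §7 (7.2); §2 (2.8)] -/
private theorem nsupp_facts {D : ℕ} (hℓ2 : 2 ≤ Skeleton.ell D) :
    3 ≤ Skeleton.Nsupp D ∧ Real.log ((Skeleton.Nsupp D : ℕ) : ℝ) ≤ 2 * Skeleton.ell D ^ 9 := by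
  have hℓ0 : 0 < Skeleton.ell D := by linarith
  set L := Skeleton.ell D with hL
  have hP : 0 < Skeleton.bigP D := Real.exp_pos _
  have hL11 : L ^ (1.1 : ℝ) ≤ L ^ 2 := by
    calc L ^ (1.1 : ℝ) ≤ L ^ ((2 : ℕ) : ℝ) :=
          Real.rpow_le_rpow_of_exponent_le (by linarith) (by norm_num)
      _ = L ^ 2 := Real.rpow_natCast L 2
  have hexp : 2 + 2 * L ^ (1.1 : ℝ) ≤ L ^ 9 := by
    have h2 : L ^ 9 = L ^ 7 * L ^ 2 := by ring
    have h3 : (2 : ℝ) ^ 7 ≤ L ^ 7 := pow_le_pow_left₀ (by norm_num) hℓ2 7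
    have h4 : (1 : ℝ) ≤ L ^ 2 := one_le_pow₀ (by linarith)
    nlinarith [pow_nonneg hℓ0.le 7, pow_nonneg hℓ0.le 2]
  have hPT : Real.exp 2 ≤ Skeleton.bigP D / Skeleton.bigT D ^ 2 := by
    have e1 : Skeleton.bigP D / Skeleton.bigT D ^ 2 =
        Real.exp (L ^ 9 - 2 * L ^ (1.1 : ℝ)) := by
      rw [Skeleton.bigP, Skeleton.bigT, sq, ← Real.exp_add, ← Real.exp_sub, ← hL]
      ring_nf
    rw [e1]
    exact Real.exp_le_exp.mpr (by linarith)
  have hN3 : 3 ≤ Skeleton.Nsupp D := by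
    have h3e : (3 : ℝ) ≤ Real.exp 2 := by
      have := Real.add_one_le_exp (2 : ℝ); linarith
    have h1 : (3 : ℝ) ≤ Skeleton.bigP D / Skeleton.bigT D ^ 2 := h3e.trans hPT
    have hle := Nat.le_ceil (Skeleton.bigP D / Skeleton.bigT D ^ 2)
    have : (3 : ℝ) ≤ ((⌈Skeleton.bigP D / Skeleton.bigT D ^ 2⌉₊ : ℕ) : ℝ) := h1.trans hle
    rw [Skeleton.Nsupp]
    exact_mod_cast this
  refine ⟨hN3, ?_⟩
  have hT1 : 1 ≤ Skeleton.bigT D ^ 2 :=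
    one_le_pow₀ (Real.one_le_exp (Real.rpow_nonneg hℓ0.le _))
  have hPT2 : Skeleton.bigP D / Skeleton.bigT D ^ 2 ≤ Skeleton.bigP D :=
    div_le_self hP.le hT1
  have hceil : ((Skeleton.Nsupp D : ℕ) : ℝ) ≤ 2 * Skeleton.bigP D := by
    rw [Skeleton.Nsupp]
    have h1 := Nat.ceil_lt_add_one
      (show 0 ≤ Skeleton.bigP D / Skeleton.bigT D ^ 2 by positivity)
    have hP1 : 1 ≤ Skeleton.bigP D := one_le_bigPS D
    calc ((⌈Skeleton.bigP D / Skeleton.bigT D ^ 2⌉₊ : ℕ) : ℝ)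
        ≤ Skeleton.bigP D / Skeleton.bigT D ^ 2 + 1 := h1.le
      _ ≤ Skeleton.bigP D + Skeleton.bigP D := by linarith [hPT2]
      _ = 2 * Skeleton.bigP D := by ring
  have hpos : (0 : ℝ) < ((Skeleton.Nsupp D : ℕ) : ℝ) := by
    exact_mod_cast (by omega : 0 < Skeleton.Nsupp D)
  have hlog2 : Real.log 2 ≤ 1 := by
    have := Real.log_le_sub_one_of_pos (show (0:ℝ) < 2 by norm_num); linarith
  have hL9 : 1 ≤ L ^ 9 := one_le_pow₀ (by linarith)
  calc Real.log ((Skeleton.Nsupp D : ℕ) : ℝ) ≤ Real.log (2 * Skeleton.bigP D) :=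
        Real.log_le_log hpos hceil
    _ = Real.log 2 + L ^ 9 := by
        rw [Real.log_mul (by norm_num) hP.ne', Skeleton.bigP, Real.log_exp, ← hL]
    _ ≤ 2 * L ^ 9 := by linarith

/-! ## The `r < D` part -/

set_option maxHeartbeats 1000000 in
/-- **The `r < D` part of the extended-range (7.13)-sum** is `≤ P²·D^{−1}` for all large `D`
under (A) and `𝐚₁` admissible: per triple `frakS_le_powX` (`A = 4`), the character count
`≤ φ(r) ≤ r`, `hr/φ(hr) ≤ (1 + 𝓛⁹)² ≤ 4𝓛¹⁸`, `√r ≤ D`, `#{r < D} ≤ D`, and the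
`Σ_d τ₅(d)/d ≤ 32M₅𝓛⁴⁵`, `Σ_h 1/h ≤ 3𝓛⁹` sums over `[1, Nsupp)`; the `𝓛`-powers are absorbed
into one power of `D`. [cite: Zhang2022LandauSiegel, §7 p. 38, tex L2022] -/
theorem sum_tripleX_smallR_le (c' : ℝ) (B : ℝ) :
    Skeleton.ForAllLarge fun D _ χ => Skeleton.AssumptionA D χ →
      ∀ a₁ : ℕ → ℂ, Skeleton.Adm72 D B a₁ →
        ∑ x ∈ (((Finset.Ico 1 (Skeleton.Nsupp D)) ×ˢ ((Finset.Ico 1 (Skeleton.Nsupp D)) ×ˢ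
              (Finset.Ico 2 (Skeleton.Nsupp D)))).filter
            (fun x => ((x.1 * x.2.1 * x.2.2 : ℕ) : ℝ) <
              Skeleton.bigP D / Skeleton.bigT D ^ 2)).filter (fun x => x.2.2 < D),
          term713 c' D a₁ x ≤
        Skeleton.bigP D ^ 2 * (D : ℝ) ^ (-(1 : ℝ)) := by
  classical
  obtain ⟨DX, hX⟩ := frakS_le_powX c' 4 B
  set M₅ : ℝ := MeanSquareMajorant.majorantConst 5 5 with hM₅
  have hM₅0 : 0 < M₅ := MeanSquareMajorant.majorantConst_pos 5 5
  obtain ⟨Dabs, habs⟩ := Skeleton.exists_mul_ell_pow_le 72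
    (show (0 : ℝ) ≤ 768 * M₅ by positivity)
  obtain ⟨Dell, hell⟩ := Skeleton.exists_nat_forall_le_ell 2
  refine ⟨DX + Dabs + Dell + 3, fun D _ χ hD hq hp hA a₁ ha => ?_⟩
  have hDX : DX ≤ D := by omega
  have hDabs : Dabs ≤ D := by omega
  have hDell : Dell ≤ D := by omega
  have hD3 : 3 ≤ D := by omega
  have hℓ2 : 2 ≤ Skeleton.ell D := hell D hDell
  have hℓ1 : 1 ≤ Skeleton.ell D := by linarith
  have hℓ0 : 0 < Skeleton.ell D := by linarith
  set L := Skeleton.ell D with hLdef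
  set P := Skeleton.bigP D with hPdef
  set N₁ : ℕ := Skeleton.Nsupp D with hN₁
  have hP1 : 1 ≤ P := one_le_bigPS D
  have hP0 : 0 < P := by linarith
  have hD0 : (0 : ℝ) < D := by exact_mod_cast (show 0 < D by omega)
  have hD1 : (1 : ℝ) ≤ D := by exact_mod_cast (show 1 ≤ D by omega)
  obtain ⟨hN3, hlogN⟩ := nsupp_facts hℓ2
  have hL9 : 1 ≤ L ^ 9 := one_le_pow₀ hℓ1
  set K₀ : ℝ := 8 * L ^ 18 * P ^ 2 * (D : ℝ) ^ (-(3 : ℝ)) with hK₀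
  have hK₀0 : 0 ≤ K₀ := by positivity
  -- per-triple bound
  have hterm : ∀ x ∈ (((Finset.Ico 1 N₁) ×ˢ ((Finset.Ico 1 N₁) ×ˢ (Finset.Ico 2 N₁))).filter
      (fun x => ((x.1 * x.2.1 * x.2.2 : ℕ) : ℝ) < P / Skeleton.bigT D ^ 2)).filter
      (fun x => x.2.2 < D),
      term713 c' D a₁ x ≤ K₀ * (MeanSquareMajorant.tau 5 x.1 / x.1) * (1 / x.2.1) := by
    rintro ⟨d, h, r⟩ hxS
    obtain ⟨hx, hrD⟩ := Finset.mem_filter.mp hxS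
    obtain ⟨hmem, hdhr⟩ := Finset.mem_filter.mp hx
    rw [Finset.mem_product] at hmem
    obtain ⟨hd_mem, hmem2⟩ := hmem
    rw [Finset.mem_product] at hmem2
    obtain ⟨hh_mem, hr_mem⟩ := hmem2
    rw [Finset.mem_Ico] at hd_mem hh_mem hr_mem
    simp only at hd_mem hh_mem hr_mem hrD hdhr ⊢
    have hd : 0 < d := hd_mem.1
    have hh : 0 < h := hh_mem.1
    have hr2 : 2 ≤ r := hr_mem.1
    have hr : 0 < r := by omega
    have hd0 : (0 : ℝ) < d := by exact_mod_cast hd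
    have hh0 : (0 : ℝ) < h := by exact_mod_cast hh
    have hr0 : (0 : ℝ) < r := by exact_mod_cast hr
    have hhr0 : 0 < h * r := Nat.mul_pos hh hr
    have hhr0' : (0 : ℝ) < ((h * r : ℕ) : ℝ) := by exact_mod_cast hhr0
    have hφ0 : (0 : ℝ) < (Nat.totient (h * r) : ℝ) := by
      exact_mod_cast Nat.totient_pos.mpr hhr0
    have hsq0 : (0 : ℝ) < Real.sqrt r := Real.sqrt_pos.mpr hr0
    -- the X-range facts
    have hd1' : (1 : ℝ) ≤ (d : ℝ) := by exact_mod_cast hd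
    have hhr1' : (1 : ℝ) ≤ (h : ℝ) * r := by
      have : (1 : ℝ) ≤ ((h * r : ℕ) : ℝ) := by exact_mod_cast hhr0
      push_cast at this
      linarith
    have hcast3 : ((d * h * r : ℕ) : ℝ) = (d : ℝ) * ((h : ℝ) * r) := by push_cast; ring
    have hcast2 : ((h * r : ℕ) : ℝ) = (h : ℝ) * r := by push_cast; ring
    have hdhrR : (d : ℝ) * ((h : ℝ) * r) < P / Skeleton.bigT D ^ 2 := by
      rw [← hcast3]; exact hdhr
    have hhrT : ((h * r : ℕ) : ℝ) ≤ P / Skeleton.bigT D ^ 2 := by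
      rw [hcast2]
      nlinarith [mul_nonneg (sub_nonneg.mpr hd1') (le_trans zero_le_one hhr1')]
    have hT21 : 1 ≤ Skeleton.bigT D ^ 2 :=
      one_le_pow₀ (Real.one_le_exp (Real.rpow_nonneg hℓ0.le _))
    have hPT2 : P / Skeleton.bigT D ^ 2 ≤ P := div_le_self hP0.le hT21
    have hdP : ((d : ℕ) : ℝ) ≤ P := by
      have h1 : (d : ℝ) ≤ (d : ℝ) * ((h : ℝ) * r) := by
        nlinarith [mul_nonneg hd0.le (sub_nonneg.mpr hhr1')]
      linarith
    -- the per-character bound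
    have hXb := fun (θ : DirichletCharacter ℂ r) (hθ : θ.IsPrimitive) =>
      hX D χ hDX hq hp hA a₁ ha d h r θ hd hh (by omega) hrD hθ hhrT hdP
    -- the character sum: `V ≤ r · (per-character bound)`
    have hV : (∑ θ : DirichletCharacter ℂ r,
        (if θ.IsPrimitive then ‖frakS c' D a₁ r h d θ‖ else 0)) ≤
        (r : ℝ) * (2 * MeanSquareMajorant.tau 5 d * ((h * r : ℕ) : ℝ) * P ^ 2 *
          (D : ℝ) ^ (-((4 : ℕ) : ℝ))) := by
      have hb0 : 0 ≤ 2 * MeanSquareMajorant.tau 5 d * ((h * r : ℕ) : ℝ) * P ^ 2 *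
          (D : ℝ) ^ (-((4 : ℕ) : ℝ)) := by
        have := MeanSquareMajorant.tau_nonneg 5 d
        positivity
      haveI : NeZero r := ⟨hr.ne'⟩
      calc (∑ θ : DirichletCharacter ℂ r,
            (if θ.IsPrimitive then ‖frakS c' D a₁ r h d θ‖ else 0))
          ≤ ∑ _θ : DirichletCharacter ℂ r,
              (2 * MeanSquareMajorant.tau 5 d * ((h * r : ℕ) : ℝ) * P ^ 2 *
                (D : ℝ) ^ (-((4 : ℕ) : ℝ))) := by
            refine Finset.sum_le_sum fun θ _ => ?_
            split_ifs with hθ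
            · exact hXb θ hθ
            · exact hb0
        _ = (Fintype.card (DirichletCharacter ℂ r) : ℝ) *
              (2 * MeanSquareMajorant.tau 5 d * ((h * r : ℕ) : ℝ) * P ^ 2 *
                (D : ℝ) ^ (-((4 : ℕ) : ℝ))) := by
            rw [Finset.sum_const, nsmul_eq_mul, Finset.card_univ]
        _ ≤ (r : ℝ) * (2 * MeanSquareMajorant.tau 5 d * ((h * r : ℕ) : ℝ) * P ^ 2 *
              (D : ℝ) ^ (-((4 : ℕ) : ℝ))) := by
            refine mul_le_mul_of_nonneg_right ?_ hb0
            have hcard : Fintype.card (DirichletCharacter ℂ r) = r.totient := by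
              rw [← Nat.card_eq_fintype_card,
                DirichletCharacter.card_eq_totient_of_hasEnoughRootsOfUnity ℂ r]
            rw [hcard]
            exact_mod_cast Nat.totient_le r
    -- the weight: `hr/φ(hr) ≤ 4𝓛¹⁸`, `r/√r = √r ≤ D`
    have hlog_hr : Real.log ((h * r : ℕ) : ℝ) ≤ L ^ 9 := by
      have h1 : ((h * r : ℕ) : ℝ) ≤ P := hhrT.trans hPT2
      calc Real.log ((h * r : ℕ) : ℝ) ≤ Real.log P := Real.log_le_log hhr0' h1
        _ = L ^ 9 := by rw [hPdef, Skeleton.bigP, Real.log_exp]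
    have hquot : ((h * r : ℕ) : ℝ) / (Nat.totient (h * r) : ℝ) ≤ 4 * L ^ 18 := by
      have h1 := Literature.NumberTheory.Sieve.natCast_div_totient_le (h * r)
      have h2 : (1 + Real.log ((h * r : ℕ) : ℝ)) ^ 2 ≤ (2 * L ^ 9) ^ 2 := by
        have hl0 : 0 ≤ 1 + Real.log ((h * r : ℕ) : ℝ) := by
          have := Real.log_natCast_nonneg (h * r); linarith
        exact pow_le_pow_left₀ hl0 (by linarith) 2
      calc ((h * r : ℕ) : ℝ) / (Nat.totient (h * r) : ℝ)
          ≤ (1 + Real.log ((h * r : ℕ) : ℝ)) ^ 2 := h1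
        _ ≤ (2 * L ^ 9) ^ 2 := h2
        _ = 4 * L ^ 18 := by ring
    have hsqrD : Real.sqrt r ≤ (D : ℝ) := by
      have h1 : (r : ℝ) ≤ D := by exact_mod_cast hrD.le
      have h2 : Real.sqrt ((D : ℕ) : ℝ) ≤ ((D : ℕ) : ℝ) := by
        nlinarith [Real.sq_sqrt hD0.le, Real.sqrt_nonneg ((D : ℕ) : ℝ), hD1]
      calc Real.sqrt r ≤ Real.sqrt D := Real.sqrt_le_sqrt h1
        _ ≤ (D : ℝ) := h2
    -- assemble the per-triple bound
    unfold term713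
    simp only
    have hrdiv : (r : ℝ) / Real.sqrt r = Real.sqrt r := Real.div_sqrt
    have hwV : (((d * h : ℕ) : ℝ) * (Nat.totient (h * r) : ℝ) * Real.sqrt r)⁻¹ *
        ((r : ℝ) * (2 * MeanSquareMajorant.tau 5 d * ((h * r : ℕ) : ℝ) * P ^ 2 *
          (D : ℝ) ^ (-((4 : ℕ) : ℝ)))) ≤
        K₀ * (MeanSquareMajorant.tau 5 d / d) * (1 / h) := by
      have hτ0 : 0 ≤ MeanSquareMajorant.tau 5 d := MeanSquareMajorant.tau_nonneg 5 d
      have hD4 : (D : ℝ) ^ (-((4 : ℕ) : ℝ)) = (D : ℝ) ^ (-(3 : ℝ)) * (D : ℝ)⁻¹ := by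
        rw [show (-((4 : ℕ) : ℝ)) = (-(3 : ℝ)) + (-1) by push_cast; ring,
          Real.rpow_add hD0, Real.rpow_neg_one]
      have hdh_cast : ((d * h : ℕ) : ℝ) = (d : ℝ) * h := by push_cast; ring
      -- rewrite the left side as a clean product with `r/√r` kept intact
      have lhs_eq : (((d * h : ℕ) : ℝ) * (Nat.totient (h * r) : ℝ) * Real.sqrt r)⁻¹ *
          ((r : ℝ) * (2 * MeanSquareMajorant.tau 5 d * ((h * r : ℕ) : ℝ) * P ^ 2 *
            (D : ℝ) ^ (-((4 : ℕ) : ℝ)))) =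
          2 * P ^ 2 * (D : ℝ) ^ (-((4 : ℕ) : ℝ)) * (MeanSquareMajorant.tau 5 d / d) * (1 / h) *
            (((h * r : ℕ) : ℝ) / (Nat.totient (h * r) : ℝ)) * ((r : ℝ) / Real.sqrt r) := by
        rw [hdh_cast]
        field_simp
        try ring
      rw [lhs_eq]
      have hstep : 2 * P ^ 2 * (D : ℝ) ^ (-((4 : ℕ) : ℝ)) * (MeanSquareMajorant.tau 5 d / d) *
          (1 / h) * (((h * r : ℕ) : ℝ) / (Nat.totient (h * r) : ℝ)) * ((r : ℝ) / Real.sqrt r) ≤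
          2 * P ^ 2 * (D : ℝ) ^ (-((4 : ℕ) : ℝ)) * (MeanSquareMajorant.tau 5 d / d) *
            (1 / h) * (4 * L ^ 18) * (D : ℝ) := by
        have hsq' : (r : ℝ) / Real.sqrt r ≤ (D : ℝ) := by rw [hrdiv]; exact hsqrD
        gcongr
      refine hstep.trans (le_of_eq ?_)
      rw [hK₀, hD4]
      field_simp
      try ring
    calc (((d * h : ℕ) : ℝ) * (Nat.totient (h * r) : ℝ) * Real.sqrt r)⁻¹ *
          ∑ θ : DirichletCharacter ℂ r,
            (if θ.IsPrimitive then ‖frakS c' D a₁ r h d θ‖ else 0)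
        ≤ (((d * h : ℕ) : ℝ) * (Nat.totient (h * r) : ℝ) * Real.sqrt r)⁻¹ *
            ((r : ℝ) * (2 * MeanSquareMajorant.tau 5 d * ((h * r : ℕ) : ℝ) * P ^ 2 *
              (D : ℝ) ^ (-((4 : ℕ) : ℝ)))) := by
          refine mul_le_mul_of_nonneg_left hV ?_
          positivity
      _ ≤ K₀ * (MeanSquareMajorant.tau 5 d / d) * (1 / h) := hwV
  -- sum the per-triple bounds over the smaller product (the `r < D` count is kept)
  have hsubset : (((Finset.Ico 1 N₁) ×ˢ ((Finset.Ico 1 N₁) ×ˢ (Finset.Ico 2 N₁))).filter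
      (fun x => ((x.1 * x.2.1 * x.2.2 : ℕ) : ℝ) < P / Skeleton.bigT D ^ 2)).filter
      (fun x => x.2.2 < D) ⊆
      (Finset.Ico 1 N₁) ×ˢ ((Finset.Ico 1 N₁) ×ˢ (Finset.Ico 2 D)) := by
    intro x hx
    obtain ⟨hx1, hrD⟩ := Finset.mem_filter.mp hx
    obtain ⟨hmem, -⟩ := Finset.mem_filter.mp hx1
    rw [Finset.mem_product] at hmem
    obtain ⟨h1, h23⟩ := hmem
    rw [Finset.mem_product] at h23
    obtain ⟨h2, h3⟩ := h23
    rw [Finset.mem_Ico] at h3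
    rw [Finset.mem_product]
    refine ⟨h1, ?_⟩
    rw [Finset.mem_product]
    refine ⟨h2, ?_⟩
    rw [Finset.mem_Ico]
    exact ⟨h3.1, hrD⟩
  have hFnn : ∀ x ∈ (Finset.Ico 1 N₁) ×ˢ ((Finset.Ico 1 N₁) ×ˢ (Finset.Ico 2 D)),
      0 ≤ K₀ * (MeanSquareMajorant.tau 5 x.1 / x.1) * (1 / x.2.1) := by
    intro x _
    have := MeanSquareMajorant.tau_nonneg 5 x.1
    positivity
  have hsum1 : ∑ x ∈ (((Finset.Ico 1 N₁) ×ˢ ((Finset.Ico 1 N₁) ×ˢ (Finset.Ico 2 N₁))).filter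
      (fun x => ((x.1 * x.2.1 * x.2.2 : ℕ) : ℝ) < P / Skeleton.bigT D ^ 2)).filter
      (fun x => x.2.2 < D), term713 c' D a₁ x ≤
      ∑ x ∈ (Finset.Ico 1 N₁) ×ˢ ((Finset.Ico 1 N₁) ×ˢ (Finset.Ico 2 D)),
        K₀ * (MeanSquareMajorant.tau 5 x.1 / x.1) * (1 / x.2.1) := by
    calc ∑ x ∈ (((Finset.Ico 1 N₁) ×ˢ ((Finset.Ico 1 N₁) ×ˢ (Finset.Ico 2 N₁))).filter
          (fun x => ((x.1 * x.2.1 * x.2.2 : ℕ) : ℝ) < P / Skeleton.bigT D ^ 2)).filter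
          (fun x => x.2.2 < D), term713 c' D a₁ x
        ≤ ∑ x ∈ (((Finset.Ico 1 N₁) ×ˢ ((Finset.Ico 1 N₁) ×ˢ (Finset.Ico 2 N₁))).filter
            (fun x => ((x.1 * x.2.1 * x.2.2 : ℕ) : ℝ) < P / Skeleton.bigT D ^ 2)).filter
            (fun x => x.2.2 < D),
            K₀ * (MeanSquareMajorant.tau 5 x.1 / x.1) * (1 / x.2.1) :=
          Finset.sum_le_sum hterm
      _ ≤ _ :=
          Finset.sum_le_sum_of_subset_of_nonneg hsubset fun x hx _ => hFnn x hx
  -- bound the product sum by the factored sums (inequality chain, no exact factorization)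
  have hcard : ((Finset.Ico 2 D).card : ℝ) ≤ (D : ℝ) := by
    rw [Nat.card_Ico]
    exact_mod_cast Nat.sub_le D 2
  have hharm : ∑ h ∈ Finset.Ico 1 N₁, (1 : ℝ) / h ≤ 3 * L ^ 9 := by
    have h1 := sum_Ico_inv_le_one_add_logS N₁
    linarith
  have hharm0 : 0 ≤ ∑ h ∈ Finset.Ico 1 N₁, (1 : ℝ) / h :=
    Finset.sum_nonneg fun h _ => by positivity
  have hinner : ∀ d ∈ Finset.Ico 1 N₁,
      (∑ y ∈ (Finset.Ico 1 N₁) ×ˢ (Finset.Ico 2 D),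
        K₀ * (MeanSquareMajorant.tau 5 d / d) * (1 / (y.1 : ℝ))) ≤
      K₀ * (MeanSquareMajorant.tau 5 d / d) * (3 * L ^ 9 * (D : ℝ)) := by
    intro d _
    have hτd0 : 0 ≤ MeanSquareMajorant.tau 5 d / d :=
      div_nonneg (MeanSquareMajorant.tau_nonneg 5 d) (Nat.cast_nonneg d)
    have hKd0 : 0 ≤ K₀ * (MeanSquareMajorant.tau 5 d / d) := mul_nonneg hK₀0 hτd0
    calc ∑ y ∈ (Finset.Ico 1 N₁) ×ˢ (Finset.Ico 2 D),
          K₀ * (MeanSquareMajorant.tau 5 d / d) * (1 / (y.1 : ℝ))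
        = ∑ h ∈ Finset.Ico 1 N₁, ∑ _r ∈ Finset.Ico 2 D,
            K₀ * (MeanSquareMajorant.tau 5 d / d) * (1 / (h : ℝ)) := Finset.sum_product _ _ _
      _ = ∑ h ∈ Finset.Ico 1 N₁, ((Finset.Ico 2 D).card : ℝ) *
            (K₀ * (MeanSquareMajorant.tau 5 d / d) * (1 / (h : ℝ))) := by
          refine Finset.sum_congr rfl fun h _ => ?_
          rw [Finset.sum_const, nsmul_eq_mul]
      _ ≤ ∑ h ∈ Finset.Ico 1 N₁, (D : ℝ) *
            (K₀ * (MeanSquareMajorant.tau 5 d / d) * (1 / (h : ℝ))) := by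
          refine Finset.sum_le_sum fun h _ => ?_
          have h0 : 0 ≤ K₀ * (MeanSquareMajorant.tau 5 d / d) * (1 / (h : ℝ)) := by positivity
          exact mul_le_mul_of_nonneg_right hcard h0
      _ = (D : ℝ) * (K₀ * (MeanSquareMajorant.tau 5 d / d)) *
            ∑ h ∈ Finset.Ico 1 N₁, (1 : ℝ) / h := by
          rw [Finset.mul_sum]
          refine Finset.sum_congr rfl fun h _ => ?_
          rw [one_div]
          ring
      _ ≤ (D : ℝ) * (K₀ * (MeanSquareMajorant.tau 5 d / d)) * (3 * L ^ 9) := by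
          refine mul_le_mul_of_nonneg_left hharm ?_
          positivity
      _ = K₀ * (MeanSquareMajorant.tau 5 d / d) * (3 * L ^ 9 * (D : ℝ)) := by ring
  have hτsum : ∑ d ∈ Finset.Ico 1 N₁, MeanSquareMajorant.tau 5 d / d ≤ 32 * M₅ * L ^ 45 := by
    have h1 := sum_Ico_tau_five_div_le hN3
    have h2 : Real.log ((N₁ : ℕ) : ℝ) ^ 5 ≤ (2 * L ^ 9) ^ 5 :=
      pow_le_pow_left₀ (Real.log_natCast_nonneg _) hlogN 5
    calc ∑ d ∈ Finset.Ico 1 N₁, MeanSquareMajorant.tau 5 d / d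
        ≤ M₅ * Real.log ((N₁ : ℕ) : ℝ) ^ 5 := h1
      _ ≤ M₅ * (2 * L ^ 9) ^ 5 := mul_le_mul_of_nonneg_left h2 hM₅0.le
      _ = 32 * M₅ * L ^ 45 := by ring
  have hτsum0 : 0 ≤ ∑ d ∈ Finset.Ico 1 N₁, MeanSquareMajorant.tau 5 d / d :=
    Finset.sum_nonneg fun d _ => div_nonneg (MeanSquareMajorant.tau_nonneg 5 d) (Nat.cast_nonneg d)
  have hfacle : ∑ x ∈ (Finset.Ico 1 N₁) ×ˢ ((Finset.Ico 1 N₁) ×ˢ (Finset.Ico 2 D)),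
      K₀ * (MeanSquareMajorant.tau 5 x.1 / x.1) * (1 / (x.2.1 : ℝ)) ≤
      K₀ * (32 * M₅ * L ^ 45) * (3 * L ^ 9 * (D : ℝ)) := by
    calc ∑ x ∈ (Finset.Ico 1 N₁) ×ˢ ((Finset.Ico 1 N₁) ×ˢ (Finset.Ico 2 D)),
          K₀ * (MeanSquareMajorant.tau 5 x.1 / x.1) * (1 / (x.2.1 : ℝ))
        = ∑ d ∈ Finset.Ico 1 N₁, ∑ y ∈ (Finset.Ico 1 N₁) ×ˢ (Finset.Ico 2 D),
            K₀ * (MeanSquareMajorant.tau 5 d / d) * (1 / (y.1 : ℝ)) := Finset.sum_product _ _ _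
      _ ≤ ∑ d ∈ Finset.Ico 1 N₁,
            K₀ * (MeanSquareMajorant.tau 5 d / d) * (3 * L ^ 9 * (D : ℝ)) :=
          Finset.sum_le_sum hinner
      _ = (∑ d ∈ Finset.Ico 1 N₁, MeanSquareMajorant.tau 5 d / d) *
            (K₀ * (3 * L ^ 9 * (D : ℝ))) := by
          rw [Finset.sum_mul]
          refine Finset.sum_congr rfl fun d _ => ?_
          ring
      _ ≤ (32 * M₅ * L ^ 45) * (K₀ * (3 * L ^ 9 * (D : ℝ))) := by
          refine mul_le_mul_of_nonneg_right hτsum ?_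
          positivity
      _ = K₀ * (32 * M₅ * L ^ 45) * (3 * L ^ 9 * (D : ℝ)) := by ring
  -- absorb the `𝓛`-powers into one power of `D`
  have habs' : 768 * M₅ * L ^ 72 ≤ D := habs D hDabs
  have hD3r : (D : ℝ) ^ (-(3 : ℝ)) * (D : ℝ) * (D : ℝ) = (D : ℝ) ^ (-(1 : ℝ)) := by
    have e1 : (D : ℝ) ^ (-(3 : ℝ)) * (D : ℝ) = (D : ℝ) ^ (-(2 : ℝ)) := by
      nth_rewrite 2 [show (D : ℝ) = (D : ℝ) ^ (1 : ℝ) from (Real.rpow_one _).symm]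
      rw [← Real.rpow_add hD0]
      norm_num
    have e2 : (D : ℝ) ^ (-(2 : ℝ)) * (D : ℝ) = (D : ℝ) ^ (-(1 : ℝ)) := by
      nth_rewrite 2 [show (D : ℝ) = (D : ℝ) ^ (1 : ℝ) from (Real.rpow_one _).symm]
      rw [← Real.rpow_add hD0]
      norm_num
    rw [e1, e2]
  calc ∑ x ∈ (((Finset.Ico 1 N₁) ×ˢ ((Finset.Ico 1 N₁) ×ˢ (Finset.Ico 2 N₁))).filter
        (fun x => ((x.1 * x.2.1 * x.2.2 : ℕ) : ℝ) < P / Skeleton.bigT D ^ 2)).filter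
        (fun x => x.2.2 < D), term713 c' D a₁ x
      ≤ ∑ x ∈ (Finset.Ico 1 N₁) ×ˢ ((Finset.Ico 1 N₁) ×ˢ (Finset.Ico 2 D)),
          K₀ * (MeanSquareMajorant.tau 5 x.1 / x.1) * (1 / (x.2.1 : ℝ)) := hsum1
    _ ≤ K₀ * (32 * M₅ * L ^ 45) * (3 * L ^ 9 * (D : ℝ)) := hfacle
    _ = (768 * M₅ * L ^ 72) * (P ^ 2 * ((D : ℝ) ^ (-(3 : ℝ)) * (D : ℝ))) := by
        rw [hK₀]; ring
    _ ≤ (D : ℝ) * (P ^ 2 * ((D : ℝ) ^ (-(3 : ℝ)) * (D : ℝ))) := by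
        have h0 : 0 ≤ P ^ 2 * ((D : ℝ) ^ (-(3 : ℝ)) * (D : ℝ)) := by positivity
        exact mul_le_mul_of_nonneg_right habs' h0
    _ = P ^ 2 * ((D : ℝ) ^ (-(3 : ℝ)) * (D : ℝ) * (D : ℝ)) := by ring
    _ = P ^ 2 * (D : ℝ) ^ (-(1 : ℝ)) := by rw [hD3r]

end Literature.NumberTheory.LFunctions.Zhang2022.Section7cStatements
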